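import Mathlib
import Summits.ResolutionOfSingularities.ResolutionOfSingularities.Theorems.WeightedInvariantLocalWeightedDropWildMonicFlagShearOrder
import Summits.ResolutionOfSingularities.ResolutionOfSingularities.Theorems.WeightedInvariantLocalWeightedDropWildMonicFlagSettingDict

/-!
# `WeightedInvariant.LocalWeightedDrop`, line `hasse-ridge-face-selection`, S3ρ sub-stub S3ρD `stub_wildMonicSurfaceDescent`: item D-0
# «maximising flag» — A PLANE SHEAR PRESERVES THE SETTING when the sheared letter is not a boundary letter (D-0d case (β))

Crux item stmt-ResolutionOfSingularities-8899 `LocalWeightedDrop` (route `ResolutionOfSingularities/WeightedInvariant`), engine of the door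
`HypersurfaceCentreConstruction` stmt-ResolutionOfSingularities-19897.  [OURS · L1 W4.3, chain w43, res-L1-w43-stub-3 (gen 3) on roadmap item
D-0 of `L/res-L1-w43-stub-7/S3RHOD-ROADMAP.md` (owners res-type-083 / stub-7); spec `L/res-L1-w43-stub-3/D0-SPEC.md` §8.  MODEL: Perlega,
arXiv:2011.14443 Ch. 5 §3 setting (p0063 L5–L30: `J₋₁ = (x^r)·I₋₁`, the letter `y` NOT exceptional, changes `y ↦ y + h(x)` «assumed
to preserve the setting») — for the plane shear alone this is AUTOMATIC: `x₁ ↦ x₁ + h(x₀)` keeps `x₀`-divisibility and total order, i.e.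
`wMin (1,0)` and `wMin (1,1)` (`…FlagShearOrder.wMin_shear` with `N ≤ M·ord h` trivially met), hence `excExp` and `dRes` for every
boundary `E ∌ 1` (`…FlagSettingDict`).  Definition-free.]

* `one_le_order_of_constantCoeff` — `h(0) = 0 ⇒ 1 ≤ ord h`;
* `wMin_one_one_shear`, `wMin_one_zero_shear` — the shear preserves `wMin (1,1)` and `wMin (1,0)`;
* **`excExp_shear_eq`**, **`dRes_shear_eq`** — for `1 ∉ E` the shear preserves the setting; **`le_sFlag_shear_of_not_mem`** /
  **`sFlag_shear_eq_of_not_mem`** — and then (`…FlagShearOrder`) it does not lower `sFlag ≥ s` when `s ≤ δ!·ord h`, and preserves a finite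
  `sFlag = s` when `s < δ!·ord h` (Per17 Lemma 5.3.3 (1)–(2), plane-shear half, now hypothesis-free).
-/

set_option linter.dupNamespace false -- mandated namespace of this single-conjunct summit

namespace Summit.ResolutionOfSingularities.ResolutionOfSingularities.Theorems

namespace WildMonic

open MvPowerSeries
open Literature.AlgebraicGeometry.Resolution

variable {k : Type} [Field k] {d : ℕ}

/-- A series without constant term has order at least `1`. -/
theorem one_le_order_of_constantCoeff {h : PowerSeries k} (hh : PowerSeries.constantCoeff h = 0) : (1 : ℕ∞) ≤ h.order := by
  refine le_trans (by norm_num) (PowerSeries.nat_le_order h 1 fun i hi => ?_)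
  interval_cases i
  rw [PowerSeries.coeff_zero_eq_constantCoeff_apply, hh]

/-- The shear preserves `wMin (1,1)` (total scaled order). -/
theorem wMin_one_one_shear {h : PowerSeries k} (hh : PowerSeries.constantCoeff h = 0) (A : Fin d → MvPowerSeries (Fin 2) k) :
    wMin ![1, 1] (fun i => subst (PurePowerFlag.shift h) (A i)) = wMin ![1, 1] A :=
  wMin_shear 1 1 hh (by rw [Nat.cast_one, one_mul]; exact one_le_order_of_constantCoeff hh) A

/-- The shear preserves `wMin (1,0)` (scaled `x₀`-multiplicity). -/
theorem wMin_one_zero_shear {h : PowerSeries k} (hh : PowerSeries.constantCoeff h = 0) (A : Fin d → MvPowerSeries (Fin 2) k) :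
    wMin ![1, 0] (fun i => subst (PurePowerFlag.shift h) (A i)) = wMin ![1, 0] A :=
  wMin_shear 1 0 hh (by rw [Nat.cast_zero]; exact bot_le) A

/-- **THE SHEAR PRESERVES THE EXCEPTIONAL EXPONENTS** when `x₁` is not a boundary letter.
[cite: Perlega2020, Ch. 5 §3 setting (arXiv:2011.14443 p0063 L5–L30)] -/
theorem excExp_shear_eq {E : Finset (Fin 2)} (hE : (1 : Fin 2) ∉ E) {h : PowerSeries k} (hh : PowerSeries.constantCoeff h = 0)
    (A : Fin d → MvPowerSeries (Fin 2) k) :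
    excExp E (newtonSet (fun i => subst (PurePowerFlag.shift h) (A i))) = excExp E (newtonSet A) :=
  excExp_eq_of_wMin_eq E (fun _ => wMin_one_zero_shear hh A) (fun h1 => absurd h1 hE)

/-- **THE SHEAR PRESERVES THE RESIDUAL ORDER** when `x₁` is not a boundary letter.
[cite: Perlega2020, Ch. 5 §3 setting (arXiv:2011.14443 p0063 L5–L30)] -/
theorem dRes_shear_eq {E : Finset (Fin 2)} (hE : (1 : Fin 2) ∉ E) {h : PowerSeries k} (hh : PowerSeries.constantCoeff h = 0)
    (A : Fin d → MvPowerSeries (Fin 2) k) :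
    dRes E (newtonSet (fun i => subst (PurePowerFlag.shift h) (A i))) = dRes E (newtonSet A) :=
  dRes_eq_of_wMin_eq E (fun _ => wMin_one_zero_shear hh A) (fun h1 => absurd h1 hE) (wMin_one_one_shear hh A)

/-- **PER17 LEMMA 5.3.3 (1), PLANE-SHEAR HALF, HYPOTHESIS-FREE** (`x₁` not a boundary letter): a shear with `s ≤ δ!·ord h` does not
lower `sFlag ≥ s`. [cite: Perlega2020, Lemma 5.3.3 (1) (arXiv:2011.14443 Ch. 5 §3, p0064 L38–L43)] -/
theorem le_sFlag_shear_of_not_mem {E : Finset (Fin 2)} (hE : (1 : Fin 2) ∉ E) (A : Fin d → MvPowerSeries (Fin 2) k)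
    {h : PowerSeries k} (hh : PowerSeries.constantCoeff h = 0) {s : ℕ} (hs : (s : ℕ∞) ≤ sFlag E (newtonSet A))
    (hsh : (s : ℕ∞) ≤ ((dRes E (newtonSet A)).factorial : ℕ∞) * h.order) :
    (s : ℕ∞) ≤ sFlag E (newtonSet (fun i => subst (PurePowerFlag.shift h) (A i))) :=
  le_sFlag_shear E E A hh hs hsh (dRes_shear_eq hE hh A) (excExp_shear_eq hE hh A)

/-- **PER17 LEMMA 5.3.3 (2), PLANE-SHEAR HALF, HYPOTHESIS-FREE** (`x₁` not a boundary letter): a shear with `s < δ!·ord h` preserves a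
finite `sFlag = s`. [cite: Perlega2020, Lemma 5.3.3 (2) (arXiv:2011.14443 Ch. 5 §3, p0064 L44–L50)] -/
theorem sFlag_shear_eq_of_not_mem {E : Finset (Fin 2)} (hE : (1 : Fin 2) ∉ E) (A : Fin d → MvPowerSeries (Fin 2) k)
    {h : PowerSeries k} (hh : PowerSeries.constantCoeff h = 0) {s : ℕ} (hs : sFlag E (newtonSet A) = s)
    (hsh : ((s + 1 : ℕ) : ℕ∞) ≤ ((dRes E (newtonSet A)).factorial : ℕ∞) * h.order) :
    sFlag E (newtonSet (fun i => subst (PurePowerFlag.shift h) (A i))) = s :=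
  sFlag_shear_eq E E A hh hs hsh (dRes_shear_eq hE hh A) (excExp_shear_eq hE hh A)

end WildMonic

end Summit.ResolutionOfSingularities.ResolutionOfSingularities.Theorems
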